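import Mathlib
import Summits.ValiantsHypothesis.ValiantsHypothesis.Theorems.GeneratorObstructionsPowGenDegreeQPSliceConstAtoms
import Literature.Computability.AlgebraicComplexity.MS2001TracePowerPolystable

/-!
# Route GeneratorObstructions — crux K2 `PowGenDegreeQP` (stmt-ValiantsHypothesis-11655), line
# `trace-side-regimes`: UNCONDITIONAL wide generator types for every inner degree `m ≥ 2`

Helper file (`--supports stmt-ValiantsHypothesis-11655`).  `GeneratorObstructionsPowGenDegreeQPWideAtoms`
produced a wide generator type of `A(Δ_m[tr X_{m+e}^m])` (`e ≥ 1`) from an OCCURRING constant weight;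
`…QuadraticWideAtoms` discharged the occurrence at `m = 2`.  With the general-exponent polystability
of power traces (`tracePow_isPolystable_complex_of_three_le`, Literature `MS2001TracePowerPolystable`
§9: `tr X_n^m` has a closed `SL_{n²}`-orbit for `n ≥ 3`, `2 ≤ m < n²`) the occurrence is discharged for
EVERY `m ≥ 2`, `e ≥ 1`:

* `powFormLex_exists_hasHighestWeight_const` — some `-k·𝟙` (`k > 0`) occurs in `ℂ[Δ_m[tr X_n^m]]`
  for `n ≥ 3`, `2 ≤ m < n²`;
* `exists_wide_genType` — for `m ≥ 2`, `e ≥ 1` and every final segment `ι` the covariant algebra of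
  `Δ_m[tr X_{m+e}^m]` has a WIDE generator type `-k₀·𝟙`, `m ≤ k₀`, of size `k₀ (m+e)²` (degree
  `k₀ (m+e)²/m ≥ (m+e)²`): the wide regime of `stub_wideGen` is populated in every window cell with
  `e ≥ 1`, by the nullcone-separation degree of the power trace;
* `wideGen_bounds_nullcone_degree` — hence the registered `stub_wideGen` (hypothesis verbatim)
  asserts in particular: throughout the window (`m ≥ 2`, `e ≥ 1`) the least `k₀` with `-k₀·𝟙`
  occurring — `k₀ (m+e)²/m` is the least degree of an `SL_{(m+e)²}`-invariant not vanishing at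
  `tr X_{m+e}^m` (BI 2017 §3.3) — satisfies `k₀ (m+e)² ≤ m · 2^((log₂ m + c₀)^c₀)`.

Honest framing: calibration; whether these nullcone-separation degrees are quasi-polynomial in the
window is open (Derksen–Makam-type lower bounds are known only for tuples of cubics / tensors);
`stub_wideGen`, `stub_sliceGen`, K2, K1 remain OPEN; `VP ≠ VNP` is not touched.
-/

namespace Summit.ValiantsHypothesis.ValiantsHypothesis.Theorems.GeneratorObstructions.PowGenDegreeQP

open MvPolynomial
open Literature.NumberTheory.DiophantineGeometry Literature.Computability.AlgebraicComplexity
open Summit.ValiantsHypothesis.ValiantsHypothesis.Theses.GeneratorObstructions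
open Summit.ValiantsHypothesis.ValiantsHypothesis.Theorems.GenInheritance
open Summit.ValiantsHypothesis.ValiantsHypothesis.Theorems.GeneratorObstructions.SliceTransfer
open Summit.ValiantsHypothesis.ValiantsHypothesis.Theorems.GeneratorObstructions.PerGenDegreeSuperQP

-- `Summit.ValiantsHypothesis.ValiantsHypothesis.…` is the tree's mandated single-conjunct layout.
set_option linter.dupNamespace false

noncomputable section

section ConstWeight

variable {n m : ℕ}

/-- **`tr X_n^m` has an occurring constant weight** (`n ≥ 3`, `2 ≤ m < n²`): some `-k·𝟙`, `k ≥ 1`,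
occurs in `ℂ[Δ_m[tr X_n^m]]` — polystability (`tracePow_isPolystable_complex_of_three_le`), Hilbert's
nonvanishing invariant (tree `exists_hasHighestWeight_const_of_isPolystable`) and transport along
`Fin (n·n) → MatIdx n`. [cite: MulmuleySohoni2001, §4.1 Remark after Thm. 4.6] -/
theorem powFormLex_exists_hasHighestWeight_const (hn : 3 ≤ n) (hm : 2 ≤ m) (hmn : m < n * n) :
    ∃ k : ℕ, 0 < k ∧
      highestWeightSpace (orbitCoordRep (powFormLex ℂ n m) m) (fun _ : MatIdx n => -(k : ℤ)) ≠ ⊥ := by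
  classical
  set e : Fin n × Fin n ≃ Fin (n * n) := finProdFinEquiv with he
  set p : MvPolynomial (Fin (n * n)) ℂ := rename e (powTrace ℂ n m) with hpdef
  have hp : p.IsHomogeneous m := (powTrace_isHomogeneous n m).rename_isHomogeneous
  have hp0 : p ≠ 0 := by
    intro h
    have hinj := rename_injective (R := ℂ) (e : Fin n × Fin n → Fin (n * n)) e.injective
    have h0 : powTrace ℂ n m = 0 := hinj (by rw [← hpdef, h, map_zero])
    apply powFormLex_ne_zero (show 1 ≤ n by omega) m
    unfold powFormLex
    rw [h0, map_zero]
  have hps : IsPolystable p := by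
    have h := tracePow_isPolystable_complex_of_three_le hn hm hmn
    rw [tracePow_eq_powTrace] at h
    exact h.rename_equiv e
  have hN : 0 < n * n := Nat.mul_pos (by omega) (by omega)
  obtain ⟨k, hk, hHW⟩ := exists_hasHighestWeight_const_of_isPolystable hN (by omega) hp hp0 hps
  refine ⟨k, hk, ?_⟩
  set κ : Fin (n * n) → MatIdx n := fun i => toLex (e.symm i) with hκ
  have hκinj : Function.Injective κ := fun i j hij => e.symm.injective (toLex.injective hij)
  have key := hasHighestWeight_orbitCoordRep_rename_dualOfPartition_iff (k := ℂ) (m := m)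
    (matIdxEquiv n) κ hκinj p (by omega) (Nat.Partition.rectangle (n * n) k)
    (Nat.Partition.card_parts_rectangle_le (n * n) k)
  rw [dualOfPartition_rectangle_self, hκ, hpdef, he, rename_powTraceFin_eq_powFormLex n m] at key
  exact key.mpr hHW

end ConstWeight

section WideAll

/-- **Wide generator types exist unconditionally for every `m ≥ 2`, `e ≥ 1`.** For every final
segment `ι : MatIdx m → MatIdx (m + e)` the covariant algebra of `Δ_m[tr X_{m+e}^m]` has a wide
generator type: the least occurring constant weight `-k₀·𝟙`, with `γ ≠ 0`, `m ≤ k₀`, and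
`-|χ| = k₀ (m+e)²`. [cite: BurgisserIkenmeyer2017, §3.3] -/
theorem exists_wide_genType {m e : ℕ} (hm : 2 ≤ m) (he : 1 ≤ e) (ι : MatIdx m → MatIdx (m + e)) :
    ∃ k₀ : ℕ, m ≤ k₀ ∧
      highestWeightSpace (orbitCoordRep (powFormLex ℂ (m + e) m) m) (fun _ => -(k₀ : ℤ)) ≠ ⊥ ∧
      (∀ k : ℕ, 0 < k → k < k₀ →
        highestWeightSpace (orbitCoordRep (powFormLex ℂ (m + e) m) m) (fun _ => -(k : ℤ)) = ⊥) ∧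
      (∃ x, x ∉ Set.range ι ∧ (fun _ : MatIdx (m + e) => -(k₀ : ℤ)) x ≠ 0) ∧
      Module.finrank ℂ (↥(highestWeightSpace (orbitCoordRep (powFormLex ℂ (m + e) m) m) (fun _ => -(k₀ : ℤ))) ⧸
        Submodule.comap (highestWeightSpace (orbitCoordRep (powFormLex ℂ (m + e) m) m) (fun _ => -(k₀ : ℤ))).subtype
          (⨆ p : Weight (MatIdx (m + e)) × Weight (MatIdx (m + e)),
            ⨆ (_ : p.1 + p.2 = (fun _ => -(k₀ : ℤ)) ∧ p.1 ≠ 0 ∧ p.2 ≠ 0),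
            highestWeightSpace (orbitCoordRep (powFormLex ℂ (m + e) m) m) p.1 *
              highestWeightSpace (orbitCoordRep (powFormLex ℂ (m + e) m) m) p.2)) ≠ 0 ∧
      -(Weight.size (fun _ : MatIdx (m + e) => -(k₀ : ℤ))) = (k₀ : ℤ) * (((m + e) * (m + e) : ℕ) : ℤ) := by
  have hmn : m < (m + e) * (m + e) := by nlinarith
  obtain ⟨k₀, hk₀pos, hocc, hmin, hwide, hγ, hsize⟩ :=
    exists_wide_genType_of_hasHighestWeight_const (m := m) (e := e) (ι := ι) (by omega) he
      (powFormLex_exists_hasHighestWeight_const (n := m + e) (by omega) hm hmn)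
  exact ⟨k₀, le_of_hasHighestWeight_const (m := m) (e := e) (by omega) hk₀pos hocc, hocc, hmin,
    hwide, hγ, hsize⟩

/-- **`stub_wideGen` ⇒ quasi-polynomial nullcone-separation degree of power traces in the window.**
With the registered `stub_wideGen` as hypothesis (verbatim): for every `c` there is `c₀` such that for
all `2 ≤ m`, `1 ≤ e`, `m + e ≤ 2^((log₂ m + c)^c)` the LEAST `k₀` with `-k₀·𝟙` occurring in
`ℂ[Δ_m[tr X_{m+e}^m]]` (it exists, `exists_wide_genType`; `k₀ (m+e)²/m` = least degree of an
`SL_{(m+e)²}`-invariant not vanishing at `tr X_{m+e}^m`) satisfies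
`k₀ (m+e)² ≤ m · 2^((log₂ m + c₀)^c₀)`. [cite: BurgisserIkenmeyer2017, §3.3] -/
theorem wideGen_bounds_nullcone_degree
    (hW : ∀ c : ℕ, ∃ c₀ : ℕ, ∀ m e : ℕ, 1 ≤ m → m + e ≤ 2 ^ ((Nat.log 2 m + c) ^ c) →
      ∀ ι : MatIdx m → MatIdx (m + e), StrictMono ι → IsUpperSet (Set.range ι) →
        ∀ χ : Weight (MatIdx (m + e)), (∃ x, x ∉ Set.range ι ∧ χ x ≠ 0) →
          Module.finrank ℂ (↥(highestWeightSpace (orbitCoordRep (powFormLex ℂ (m + e) m) m) (χ)) ⧸ Submodule.comap (highestWeightSpace (orbitCoordRep (powFormLex ℂ (m + e) m) m) (χ)).subtype (⨆ p : Weight (MatIdx (m + e)) × Weight (MatIdx (m + e)), ⨆ (_ : p.1 + p.2 = (χ) ∧ p.1 ≠ 0 ∧ p.2 ≠ 0), highestWeightSpace (orbitCoordRep (powFormLex ℂ (m + e) m) m) p.1 * highestWeightSpace (orbitCoordRep (powFormLex ℂ (m + e) m) m) p.2)) ≠ 0 →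
            -(Weight.size χ) ≤ (m : ℤ) * 2 ^ ((Nat.log 2 m + c₀) ^ c₀)) :
    ∀ c : ℕ, ∃ c₀ : ℕ, ∀ m e : ℕ, 2 ≤ m → 1 ≤ e → m + e ≤ 2 ^ ((Nat.log 2 m + c) ^ c) →
      ∃ k₀ : ℕ, m ≤ k₀ ∧
        highestWeightSpace (orbitCoordRep (powFormLex ℂ (m + e) m) m) (fun _ => -(k₀ : ℤ)) ≠ ⊥ ∧
        (∀ k : ℕ, 0 < k → k < k₀ →
          highestWeightSpace (orbitCoordRep (powFormLex ℂ (m + e) m) m) (fun _ => -(k : ℤ)) = ⊥) ∧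
        (k₀ : ℤ) * (((m + e) * (m + e) : ℕ) : ℤ) ≤ (m : ℤ) * 2 ^ ((Nat.log 2 m + c₀) ^ c₀) := by
  intro c
  obtain ⟨c₀, hc₀⟩ := hW c
  refine ⟨c₀, fun m e hm he hwin => ?_⟩
  obtain ⟨ι, hι, hup⟩ := exists_finalSegment (n := m) (n' := m + e) (Nat.le_add_right m e)
  obtain ⟨k₀, hk₀, hocc, hmin, hwide, hγ, hsize⟩ := exists_wide_genType hm he ι
  refine ⟨k₀, hk₀, hocc, hmin, ?_⟩
  rw [← hsize]
  exact hc₀ m e (by omega) hwin ι hι hup _ hwide hγ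

end WideAll

end

end Summit.ValiantsHypothesis.ValiantsHypothesis.Theorems.GeneratorObstructions.PowGenDegreeQP
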